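import Literature.Computability.Complexity.BoundedArithmetic
import Literature.Computability.Complexity.BoundedArithmeticProofs
import Literature.Computability.Complexity.BoundedArithmeticDefinabilityProofs
import Literature.Analysis.FunctionSpaces.PVFunctionsProofs
import Literature.Analysis.FunctionSpaces.BussWitnessingPV
import HarnessLib

/-!
# Buss's witnessing theorem, polynomial-time form: reduction to the `PV` form

Sibling proof file of `BoundedArithmetic.lean` (D-0014) for the named fact
`polyTimeComputable_of_isSigmabDefinable_S2_one` — the witnessing direction of Buss's Main
Theorem: every function `Σᵇ₁`-definable in `S₂¹` is polynomial-time computable (Buss 1986, Ch. 5,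
Main Theorem; Krajíček 1995, Thm. 7.2.3 and Cor. 7.2.6 for `i = 1`).

The classical proof factors through Cook's `PV` / Cobham's function algebra:

1. (*witnessing, machine-independent form*) a function `Σᵇ₁`-definable in `S₂¹` is `PV`-definable
   — Buss 1986, Ch. 5–6; Krajíček 1995, Thm. 7.2.3 / model-theoretically Thm. 7.6.3 and
   pp. 116–117 (after Zambella 1996), Avigad 2002, §4; in the tree this is the direction `←` of
   the named fact `Literature.Analysis.FunctionSpaces.isPVDefinable_iff_isSigmabDefinable`;
2. (*Cobham's theorem, easy direction*) every `PV`-definable function is polynomial-time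
   computable on binary notation — Cobham 1965; Krajíček 1995, Thm. 5.3.1; **proved** in
   `Literature/Analysis/FunctionSpaces/PVFunctionsProofs.lean`
   (`polyTimeComputable_of_isPVDefinable`, part of `cobham_holds`).

This file records the resulting reductions, fully proved:

* `polyTimeComputable_of_isSigmabDefinable_S2_one_of_witnessPV` — step 1 (as a hypothesis, in
  its minimal form) implies the fact;
* `polyTimeComputable_of_isSigmabDefinable_S2_one_of_iff` — in particular the fact follows from
  `isPVDefinable_iff_isSigmabDefinable`.

## Buss's Main Theorem (both directions) and its corollary for `S₂ⁱ`

With the converse direction — every polynomial-time computable `f : ℕ → ℕ` is `Σᵇ₁`-definable in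
`S₂¹`, `isSigmabDefinable_S2_one_of_polyTimeComputable_holds`
(`BoundedArithmeticDefinabilityProofs.lean`; Buss 1986, Ch. 3 and Ch. 5, Main Theorem, easy
direction; Krajíček 1995, Lemma 6.1.1) — the two halves assemble into the discharge of the
principal named fact of `BoundedArithmetic.lean`:

* `buss_witnessing_holds : buss_witnessing` — **Buss's Main Theorem** (Buss 1986, Ch. 5, Main
  Theorem 5; Krajíček 1995, Thm. 7.2.3): `f : ℕ → ℕ` is `Σᵇ₁`-definable in `S₂¹` iff it is
  polynomial-time computable on binary notation;
* `isSigmabDefinable_S2_of_polyTimeComputable_holds` — polynomial-time functions are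
  `Σᵇ₁`-definable in every `S₂ⁱ`, `i ≥ 1` (by `S₂¹ ⊆ S₂ⁱ`, the reduction
  `isSigmabDefinable_S2_of_polyTimeComputable_of_S2_one` of `BoundedArithmeticProofs.lean`).

## References

* S. R. Buss, *Bounded Arithmetic*, Bibliopolis 1986, Ch. 5 (Main Theorem), Ch. 6 (`S₂¹(PV)`).
* J. Krajíček, *Bounded Arithmetic, Propositional Logic and Complexity Theory*, CUP 1995,
  Thm. 5.3.1 (Cobham), Thm. 7.2.3, Cor. 7.2.6, Thm. 7.6.3 and pp. 116–117.
* A. Cobham, *The intrinsic computational difficulty of functions*, 1965.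
-/

namespace Literature.Computability.Complexity

open _root_.Computability Literature.Computability.MetaComplexity Literature.Analysis.FunctionSpaces

/-- **Witnessing in `PV` form implies witnessing in polynomial-time form.**  If every function
`Σᵇ₁`-definable in `S₂¹` is `PV`-definable (Buss 1986, Ch. 5–6; Krajíček 1995, Thm. 7.2.3), then
every such function is polynomial-time computable on binary notation — by the easy direction of
Cobham's theorem, `polyTimeComputable_of_isPVDefinable` (Krajíček 1995, Thm. 5.3.1).
[cite: Krajicek1995, Thm. 7.2.3 and Thm. 5.3.1] -/
theorem polyTimeComputable_of_isSigmabDefinable_S2_one_of_witnessPV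
    (h : ∀ F : ℕ → ℕ, IsSigmabDefinable (S2 1) 1 F → IsPVDefinable fun v : Fin 1 → ℕ => F (v 0)) :
    polyTimeComputable_of_isSigmabDefinable_S2_one :=
  fun {_} hf => polyTimeComputable_of_isPVDefinable (h _ hf)

/-- **The fact `polyTimeComputable_of_isSigmabDefinable_S2_one` follows from
`isPVDefinable_iff_isSigmabDefinable`** (Buss's Main Theorem in `PV` form) and the (proved) easy
direction of Cobham's theorem. [cite: Krajicek1995, Thm. 7.2.3 and Thm. 5.3.1] -/
theorem polyTimeComputable_of_isSigmabDefinable_S2_one_of_iff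
    (h : isPVDefinable_iff_isSigmabDefinable) : polyTimeComputable_of_isSigmabDefinable_S2_one :=
  polyTimeComputable_of_isSigmabDefinable_S2_one_of_witnessPV fun F hF => (h F).2 hF

/-- **Discharge of `polyTimeComputable_of_isSigmabDefinable_S2_one`** — the witnessing direction
of Buss's Main Theorem: every function `Σᵇ₁`-definable in `S₂¹` is polynomial-time computable on
binary notation (Buss 1986, Ch. 5, Main Theorem; Krajíček 1995, Thm. 7.2.3 / Cor. 7.2.6 for
`i = 1`).  Step 1 (witnessing in `PV` form) is the theorem
`Literature.Analysis.FunctionSpaces.isPVDefinable_of_isSigmabDefinable_S2_one`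
(`BussWitnessingPV.lean`, proved model-theoretically after Zambella 1996 / Avigad 2002 via
Herbrand-saturated models of the true universal theory of `(ℕ, PV)`), step 2 is the easy
direction of Cobham's theorem (`polyTimeComputable_of_isPVDefinable`).
[cite: Buss1986, Ch. 5, Main Theorem 5] -/
theorem polyTimeComputable_of_isSigmabDefinable_S2_one_holds :
    polyTimeComputable_of_isSigmabDefinable_S2_one :=
  polyTimeComputable_of_isSigmabDefinable_S2_one_of_witnessPV fun _ hF =>
    isPVDefinable_of_isSigmabDefinable_S2_one hF

/-! ## Buss's Main Theorem -/

/-- **Discharge of `buss_witnessing` — Buss's Main Theorem** (Buss 1986, Ch. 5, Main Theorem 5;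
Krajíček 1995, Thm. 7.2.3 with Lemma 6.1.1): a function `f : ℕ → ℕ` is `Σᵇ₁`-definable in `S₂¹`
(for Mathlib's semantic consequence `⊨ᵇ`) if and only if it is computable in polynomial time on
binary notation (Mathlib's `TM2` model, `Computability.encodeNat`).  `→` is the witnessing
theorem `polyTimeComputable_of_isSigmabDefinable_S2_one_holds` (this file: witnessing in `PV`
form, `isPVDefinable_of_isSigmabDefinable_S2_one`, followed by the easy direction of Cobham's
theorem); `←` is `isSigmabDefinable_S2_one_of_polyTimeComputable_holds`
(`BoundedArithmeticDefinabilityProofs.lean`: the graph of the padded `TM2` computation is a `Σᵇ₁`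
definition, total and functional in every model of `S₂¹`).
[cite: Buss1986, Ch. 5, Main Theorem 5] [cite: Krajicek1995, Thm. 7.2.3 (pp. 97–98) and Lemma 6.1.1 (p. 86)] -/
theorem buss_witnessing_holds : buss_witnessing := fun _ =>
  ⟨fun hf => polyTimeComputable_of_isSigmabDefinable_S2_one_holds hf,
    fun hf => isSigmabDefinable_S2_one_of_polyTimeComputable_holds hf⟩

/-- **Discharge of `isSigmabDefinable_S2_of_polyTimeComputable`**: every polynomial-time
computable `f : ℕ → ℕ` is `Σᵇ₁`-definable in `S₂ⁱ` for every `i ≥ 1` (Buss 1986, Ch. 5, Main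
Theorem, easy direction, with `S₂¹ ⊆ S₂ⁱ`, §2.4).  The instance `i = 1` is
`isSigmabDefinable_S2_one_of_polyTimeComputable_holds`; the reduction to it is
`isSigmabDefinable_S2_of_polyTimeComputable_of_S2_one` (`BoundedArithmeticProofs.lean`,
`IsSigmabDefinable.mono_subset` along `S2_mono_holds`).
[cite: Buss1986, §2.4 and Ch. 5, Main Theorem 5] -/
theorem isSigmabDefinable_S2_of_polyTimeComputable_holds :
    isSigmabDefinable_S2_of_polyTimeComputable :=
  isSigmabDefinable_S2_of_polyTimeComputable_of_S2_one
    isSigmabDefinable_S2_one_of_polyTimeComputable_holds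

end Literature.Computability.Complexity
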